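import Summits.SmoothPoincare4.SmoothPoincare4.Theorems.SymplecticOrigamiGromovRecognitionRelEndOneFoliation
import Summits.SmoothPoincare4.SmoothPoincare4.Theorems.SymplecticOrigamiGromovRecognitionRelEndJoint
import Summits.SmoothPoincare4.SmoothPoincare4.Theorems.SymplecticOrigamiGromovRecognitionRelEndCapFoliationData

/-!
# Stub `stub_coreGlue` of line `cross-cap-laurent` — THE GLUE of the bi-foliation, with both
Gromov–McDuff fibrations `helper_twoFamilies` (crux `GromovRecognitionRelEnd`, item stmt-SmoothPoincare4-11009)

* `helper_twoFamilies` (registered L10): from the data of the `V`-fibration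
  `FoliationData ωX JX u₀ v₀ uH vH F₀ TH TV UH UV δ` and of the `H`-fibration (roles of the
  reference sphere `V∞ = (u₀, v₀)` and of the transverse wedge sphere `H∞ = (uH, vH)` exchanged),
  `helper_oneFoliation` gives the two smooth retractions `lamV : X → H∞`, `lamH : X → V∞` along the
  leaves with `JX`-invariant kernels equal to the leaf tangents, and `helper_joint` (a `V`-leaf and
  an `H`-leaf meet in exactly one point, transversally) gives joint injectivity / surjectivity of
  `(lamV, lamH)` and transversality of the kernels.  Pure logic.
* `stub_coreGlue` (registered): the two transversal `JX`-holomorphic fibrations of the wedge cap in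
  retraction form, from the six vendored Literature facts, = `helper_twoFamilies` applied to the
  concrete foliation data of the cap `helper_capFoliationData`, followed by the translation of the
  `pairImage` clauses of the two wedge spheres into the axis clauses of the cap charts
  (`mem_pairImage_H_iff`, `mem_pairImage_V_iff`).  The local notation `E4` is that of the skeleton.
No new definitions.
-/

noncomputable section

open scoped Manifold ContDiff Topology
open Set Function Filter Literature.Topology.FourManifolds Literature.Topology.FourManifolds.ComplexProjectiveSpace
  Literature.Geometry.Kaehler Literature.Geometry.Symplectic Literature.AlgebraicTopology.SingularHomology

-- the prescribed namespace `Summit.<P>.<Sub>.…` duplicates `SmoothPoincare4` (P = Sub)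
set_option linter.dupNamespace false

namespace Summit.SmoothPoincare4.SmoothPoincare4.Theorems.GromovRecognitionRelEnd.CrossCapLaurent

/-- The tangent directions of a leaf at one of its points `y`, in the form used by `helper_joint`:
from the kernel characterisation of `helper_oneFoliation` at `y`. -/
theorem tangent_of_ker {X : Type} [TopologicalSpace X] [ChartedSpace (EuclideanSpace ℝ (Fin 4)) X]
    [IsManifold (𝓡 4) ∞ X] {lam : X → X} {u v : ℂ → X} {y : X} (hy : y ∈ pairImage u v)
    (hu : ∀ z : ℂ, u z = y → ∀ ξ : TangentSpace (𝓡 4) y,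
      mfderiv (𝓡 4) (𝓡 4) lam y ξ = 0 ↔ ξ ∈ range (mfderiv 𝓘(ℝ, ℂ) (𝓡 4) u z))
    (hv : v 0 = y → ∀ ξ : TangentSpace (𝓡 4) y,
      mfderiv (𝓡 4) (𝓡 4) lam y ξ = 0 ↔ ξ ∈ range (mfderiv 𝓘(ℝ, ℂ) (𝓡 4) v 0))
    {ξ : TangentSpace (𝓡 4) y} (hξ : mfderiv (𝓡 4) (𝓡 4) lam y ξ = 0) :
    (∃ z : ℂ, u z = y ∧ ξ ∈ range (mfderiv 𝓘(ℝ, ℂ) (𝓡 4) u z)) ∨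
      (v 0 = y ∧ ξ ∈ range (mfderiv 𝓘(ℝ, ℂ) (𝓡 4) v 0)) := by
  rw [mem_pairImage_iff] at hy
  rcases hy with ⟨z, hz⟩ | hyv
  · exact Or.inl ⟨z, hz, (hu z hz ξ).1 hξ⟩
  · exact Or.inr ⟨hyv.symm, (hv hyv.symm ξ).1 hξ⟩

/-- **`helper_twoFamilies` (L10): both fibrations and the joint clauses**, in the abstract form of
the registered core (image of the transverse sphere written as `pairImage`): the two smooth
retractions `lamV` onto `H∞` and `lamH` onto `V∞` along the `V`- and `H`-leaves, their corner
fibres, `JX`-invariant kernels, joint injectivity/surjectivity and kernel transversality. -/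
theorem helper_twoFamilies : ∀ (X : Type) [TopologicalSpace X] [T2Space X]
    [SecondCountableTopology X] [CompactSpace X] [ConnectedSpace X]
    [ChartedSpace (EuclideanSpace ℝ (Fin 4)) X] [IsManifold (𝓡 4) ∞ X] (ωX : MForm (𝓡 4) X ℝ 2)
    (JX : AlmostComplexStructure (𝓡 4) ∞ X) (u₀ v₀ uH vH : ℂ → X)
    (F₀ FH : C(ComplexProjectiveSpace 1, X)) (TH TV : X → ℂ) (UH UV : Set X) (δ : ℝ),
    hls_localFoliation_embeddedSphere_trivialNormal → gromovCompactness_spheres_dichotomy →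
    positivityOfIntersections_leafCoordinate → adjunction_embedded_of_somewhereInjective_sphere →
    jSphere_wedgeCount_factorsThroughHomology → sphere_zeroSetIndex_factorsThroughHomology →
    FoliationData ωX JX u₀ v₀ uH vH F₀ TH TV UH UV δ →
    FoliationData ωX JX uH vH u₀ v₀ FH TV TH UV UH δ →
    ∃ lamV lamH : X → X,
      ContMDiff (𝓡 4) (𝓡 4) ∞ lamV ∧ ContMDiff (𝓡 4) (𝓡 4) ∞ lamH ∧
      (∀ y, lamV y ∈ pairImage uH vH) ∧ (∀ y ∈ pairImage uH vH, lamV y = y) ∧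
      (∀ y, lamH y ∈ pairImage u₀ v₀) ∧ (∀ y ∈ pairImage u₀ v₀, lamH y = y) ∧
      (∀ y, lamV y = v₀ 0 ↔ y ∈ pairImage u₀ v₀) ∧
      (∀ y, lamH y = v₀ 0 ↔ y ∈ pairImage uH vH) ∧
      (∀ y y' : X, lamV y = lamV y' → lamH y = lamH y' → y = y') ∧
      (∀ p q : X, p ∈ pairImage uH vH → q ∈ pairImage u₀ v₀ →
        ∃ y : X, lamV y = p ∧ lamH y = q) ∧
      (∀ (y : X) (ξ : TangentSpace (𝓡 4) y), mfderiv (𝓡 4) (𝓡 4) lamV y ξ = 0 →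
        mfderiv (𝓡 4) (𝓡 4) lamV y (JX y ξ) = 0) ∧
      (∀ (y : X) (ξ : TangentSpace (𝓡 4) y), mfderiv (𝓡 4) (𝓡 4) lamH y ξ = 0 →
        mfderiv (𝓡 4) (𝓡 4) lamH y (JX y ξ) = 0) ∧
      (∀ (y : X) (ξ : TangentSpace (𝓡 4) y), mfderiv (𝓡 4) (𝓡 4) lamV y ξ = 0 →
        mfderiv (𝓡 4) (𝓡 4) lamH y ξ = 0 → ξ = 0) := by
  intro X _ _ _ _ _ _ _ ωX JX u₀ v₀ uH vH F₀ FH TH TV UH UV δ hF1 hF2 hF3 hF4 hF6 hF6' D D'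
  obtain ⟨lamV, hVs, hVmem, hVret, hVcor, hVJ, hVloc⟩ :=
    helper_oneFoliation X ωX JX u₀ v₀ uH vH F₀ TH TV UH UV δ hF1 hF2 hF6 hF4 D
  obtain ⟨lamH, hHs, hHmem, hHret, hHcor, hHJ, hHloc⟩ :=
    helper_oneFoliation X ωX JX uH vH u₀ v₀ FH TV TH UV UH δ hF1 hF2 hF6 hF4 D'
  have joint := helper_joint X ωX JX u₀ v₀ uH vH F₀ FH TH TV UH UV δ hF1 hF3 hF4 hF6 hF6' D D'
  refine ⟨lamV, lamH, hVs, hHs, hVmem, hVret, hHmem, hHret, hVcor, fun y => ?_,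
    fun y y' h1 h2 => ?_, fun p q hp hq => ?_, hVJ, hHJ, fun y ξ hξV hξH => ?_⟩
  · -- the corner fibre of `lamH` is the transverse wedge sphere
    rw [← D.corner]
    exact hHcor y
  · -- joint injectivity: `y'` lies on the `V`-leaf and on the `H`-leaf through `y`
    obtain ⟨u, v, hl, hy, hfib, -, -⟩ := hVloc y
    obtain ⟨u', v', hl', hy', hfib', -, -⟩ := hHloc y
    exact (joint u v u' v' hl hl').2.1 y y' hy hy' ((hfib y').2 h1.symm) ((hfib' y').2 h2.symm)
  · -- joint surjectivity: the `V`-leaf through `p` meets the `H`-leaf through `q`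
    obtain ⟨u, v, hl, hp', hfib, -, -⟩ := hVloc p
    obtain ⟨u', v', hl', hq', hfib', -, -⟩ := hHloc q
    obtain ⟨y, hy, hy'⟩ := (joint u v u' v' hl hl').1
    refine ⟨y, ?_, ?_⟩
    · rw [(hfib y).1 hy]
      exact hVret p hp
    · rw [(hfib' y).1 hy']
      exact hHret q hq
  · -- kernel transversality: `ξ` is tangent to both leaves through `y`
    obtain ⟨u, v, hl, hy, -, hku, hkv⟩ := hVloc y
    obtain ⟨u', v', hl', hy', -, hku', hkv'⟩ := hHloc y
    exact (joint u v u' v' hl hl').2.2 y hy hy' ξ (tangent_of_ker hy hku hkv hξV)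
      (tangent_of_ker hy' hku' hkv' hξH)

/-! ## Translation lemmas between the cap-chart axis clauses and `pairImage` -/

section Axis

variable {X : Type}

/-- A vector with vanishing last two coordinates is `(p 0, p 1, 0, 0)`. -/
theorem eq_toLp_of_coord23_eq_zero (p : EuclideanSpace ℝ (Fin 4)) (h2 : p 2 = 0) (h3 : p 3 = 0) :
    p = WithLp.toLp 2 ![p 0, p 1, 0, 0] := by
  ext i
  fin_cases i <;> simp [h2, h3]

/-- A vector with vanishing first two coordinates is `(0, 0, p 2, p 3)`. -/
theorem eq_toLp_of_coord01_eq_zero (p : EuclideanSpace ℝ (Fin 4)) (h0 : p 0 = 0) (h1 : p 1 = 0) :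
    p = WithLp.toLp 2 ![0, 0, p 2, p 3] := by
  ext i
  fin_cases i <;> simp [h0, h1]

/-- Points of the `H`-wedge sphere in axis form. -/
theorem mem_pairImage_H_iff {ηH ηC : EuclideanSpace ℝ (Fin 4) → X} {uH vH : ℂ → X}
    (huH : ∀ z : ℂ, uH z = ηH (WithLp.toLp 2 ![z.re, z.im, 0, 0])) (hvH : vH 0 = ηC 0) (y : X) :
    y ∈ pairImage uH vH ↔
      (∃ p : EuclideanSpace ℝ (Fin 4), p 2 = 0 ∧ p 3 = 0 ∧ ηH p = y) ∨ y = ηC 0 := by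
  rw [mem_pairImage_iff, hvH]
  constructor
  · rintro (⟨z, rfl⟩ | h)
    · exact Or.inl ⟨WithLp.toLp 2 ![z.re, z.im, 0, 0], by simp, by simp, (huH z).symm⟩
    · exact Or.inr h
  · rintro (⟨p, h2, h3, rfl⟩ | h)
    · refine Or.inl ⟨⟨p 0, p 1⟩, ?_⟩
      rw [huH, eq_toLp_of_coord23_eq_zero p h2 h3]
      simp
    · exact Or.inr h

/-- Points of the `V`-wedge sphere in axis form. -/
theorem mem_pairImage_V_iff {ηV ηC : EuclideanSpace ℝ (Fin 4) → X} {u₀ v₀ : ℂ → X}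
    (hu₀ : ∀ z : ℂ, u₀ z = ηV (WithLp.toLp 2 ![0, 0, z.re, z.im])) (hv₀ : v₀ 0 = ηC 0) (y : X) :
    y ∈ pairImage u₀ v₀ ↔
      (∃ q : EuclideanSpace ℝ (Fin 4), q 0 = 0 ∧ q 1 = 0 ∧ ηV q = y) ∨ y = ηC 0 := by
  rw [mem_pairImage_iff, hv₀]
  constructor
  · rintro (⟨z, rfl⟩ | h)
    · exact Or.inl ⟨WithLp.toLp 2 ![0, 0, z.re, z.im], by simp, by simp, (hu₀ z).symm⟩
    · exact Or.inr h
  · rintro (⟨q, h0, h1, rfl⟩ | h)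
    · refine Or.inl ⟨⟨q 2, q 3⟩, ?_⟩
      rw [hu₀, eq_toLp_of_coord01_eq_zero q h0 h1]
      simp
    · exact Or.inr h

end Axis

/-- Model space `ℝ⁴ = ℂ²` (coordinates `0,1` = `z₁`, `2,3` = `z₂`). -/
local notation "E4" => EuclideanSpace ℝ (Fin 4)

/-- **Stub 4b-G — THE GLUE** (registered `stub_coreGlue`): the two transversal `JX`-holomorphic
fibrations of the wedge cap in retraction form, from the six vendored facts, via
`helper_twoFamilies` on the concrete foliation data `helper_capFoliationData`. -/
theorem stub_coreGlue :
    Literature.Geometry.Symplectic.hls_localFoliation_embeddedSphere_trivialNormal →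
    Literature.Geometry.Symplectic.gromovCompactness_spheres_dichotomy →
    Literature.Geometry.Symplectic.positivityOfIntersections_leafCoordinate →
    Literature.Geometry.Symplectic.adjunction_embedded_of_somewhereInjective_sphere →
    Literature.Geometry.Symplectic.jSphere_wedgeCount_factorsThroughHomology →
    Literature.Geometry.Symplectic.sphere_zeroSetIndex_factorsThroughHomology →
    ∀ (M : Type) [TopologicalSpace M] [T2Space M] [SecondCountableTopology M]
      [ChartedSpace E4 M] [IsManifold (𝓡 4) ∞ M] [ConnectedSpace M]
      (J : AlmostComplexStructure (𝓡 4) ∞ M) (R₁ : ℝ) (χ : E4 → M),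
      (∀ x : M, Subsingleton (π_ 2 M x)) →
      0 < R₁ →
      ∀ (X : Type) [TopologicalSpace X] [T2Space X] [SecondCountableTopology X] [CompactSpace X]
        [ConnectedSpace X] [ChartedSpace E4 X] [IsManifold (𝓡 4) ∞ X]
        (ωX : MForm (𝓡 4) X ℝ 2) (JX : AlmostComplexStructure (𝓡 4) ∞ X) (ι : M → X)
        (ηH ηV ηC : E4 → X),
        (IsSmoothForm ωX ∧ IsClosedForm ωX ∧ JX.IsTamedBy ωX) ∧
        (IsLocalDiffeomorph (𝓡 4) (𝓡 4) ∞ ι ∧ Function.Injective ι ∧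
          ∀ (x : M) (v : TangentSpace (𝓡 4) x),
            JX (ι x) (mfderiv (𝓡 4) (𝓡 4) ι x v) = mfderiv (𝓡 4) (𝓡 4) ι x (J x v)) ∧
        (IsLocalDiffeomorphOn 𝓘(ℝ, E4) (𝓡 4) ∞ ηV {p : E4 | p 0 ^ 2 + p 1 ^ 2 < R₁⁻¹ ^ 2} ∧
          Set.InjOn ηV {p : E4 | p 0 ^ 2 + p 1 ^ 2 < R₁⁻¹ ^ 2} ∧
          (∀ p : E4, p 0 ^ 2 + p 1 ^ 2 < R₁⁻¹ ^ 2 → (p 0 ≠ 0 ∨ p 1 ≠ 0) →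
            ηV p = ι (χ (WithLp.toLp 2
              ![p 0 / (p 0 ^ 2 + p 1 ^ 2), -(p 1) / (p 0 ^ 2 + p 1 ^ 2), p 2, p 3]))) ∧
          (∀ p : E4, p 0 = 0 → p 1 = 0 → ηV p ∉ Set.range ι) ∧
          (∀ p : E4, p 0 ^ 2 + p 1 ^ 2 < R₁⁻¹ ^ 2 → ∀ q : E4,
            JX (ηV p) (mfderiv 𝓘(ℝ, E4) (𝓡 4) ηV p q) =
              mfderiv 𝓘(ℝ, E4) (𝓡 4) ηV p (WithLp.toLp 2 ![-(q 1), q 0, -(q 3), q 2]))) ∧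
        (IsLocalDiffeomorphOn 𝓘(ℝ, E4) (𝓡 4) ∞ ηH {p : E4 | p 2 ^ 2 + p 3 ^ 2 < R₁⁻¹ ^ 2} ∧
          Set.InjOn ηH {p : E4 | p 2 ^ 2 + p 3 ^ 2 < R₁⁻¹ ^ 2} ∧
          (∀ p : E4, p 2 ^ 2 + p 3 ^ 2 < R₁⁻¹ ^ 2 → (p 2 ≠ 0 ∨ p 3 ≠ 0) →
            ηH p = ι (χ (WithLp.toLp 2
              ![p 0, p 1, p 2 / (p 2 ^ 2 + p 3 ^ 2), -(p 3) / (p 2 ^ 2 + p 3 ^ 2)]))) ∧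
          (∀ p : E4, p 2 = 0 → p 3 = 0 → ηH p ∉ Set.range ι) ∧
          (∀ p : E4, p 2 ^ 2 + p 3 ^ 2 < R₁⁻¹ ^ 2 → ∀ q : E4,
            JX (ηH p) (mfderiv 𝓘(ℝ, E4) (𝓡 4) ηH p q) =
              mfderiv 𝓘(ℝ, E4) (𝓡 4) ηH p (WithLp.toLp 2 ![-(q 1), q 0, -(q 3), q 2]))) ∧
        (IsLocalDiffeomorphOn 𝓘(ℝ, E4) (𝓡 4) ∞ ηC
            {p : E4 | p 0 ^ 2 + p 1 ^ 2 < R₁⁻¹ ^ 2 ∧ p 2 ^ 2 + p 3 ^ 2 < R₁⁻¹ ^ 2} ∧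
          Set.InjOn ηC {p : E4 | p 0 ^ 2 + p 1 ^ 2 < R₁⁻¹ ^ 2 ∧ p 2 ^ 2 + p 3 ^ 2 < R₁⁻¹ ^ 2} ∧
          (∀ p : E4, p 0 ^ 2 + p 1 ^ 2 < R₁⁻¹ ^ 2 → p 2 ^ 2 + p 3 ^ 2 < R₁⁻¹ ^ 2 →
            (p 2 ≠ 0 ∨ p 3 ≠ 0) →
            ηC p = ηV (WithLp.toLp 2
              ![p 0, p 1, p 2 / (p 2 ^ 2 + p 3 ^ 2), -(p 3) / (p 2 ^ 2 + p 3 ^ 2)])) ∧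
          (∀ p : E4, p 0 ^ 2 + p 1 ^ 2 < R₁⁻¹ ^ 2 → p 2 ^ 2 + p 3 ^ 2 < R₁⁻¹ ^ 2 →
            (p 0 ≠ 0 ∨ p 1 ≠ 0) →
            ηC p = ηH (WithLp.toLp 2
              ![p 0 / (p 0 ^ 2 + p 1 ^ 2), -(p 1) / (p 0 ^ 2 + p 1 ^ 2), p 2, p 3])) ∧
          ηC 0 ∉ Set.range ι ∧
          (∀ p : E4, p 0 ^ 2 + p 1 ^ 2 < R₁⁻¹ ^ 2 → p 2 ^ 2 + p 3 ^ 2 < R₁⁻¹ ^ 2 → ∀ q : E4,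
            JX (ηC p) (mfderiv 𝓘(ℝ, E4) (𝓡 4) ηC p q) =
              mfderiv 𝓘(ℝ, E4) (𝓡 4) ηC p (WithLp.toLp 2 ![-(q 1), q 0, -(q 3), q 2]))) ∧
        (∀ y : X, y ∈ Set.range ι ∨ (∃ p : E4, p 0 ^ 2 + p 1 ^ 2 < R₁⁻¹ ^ 2 ∧ ηV p = y) ∨
          (∃ p : E4, p 2 ^ 2 + p 3 ^ 2 < R₁⁻¹ ^ 2 ∧ ηH p = y) ∨
          (∃ p : E4, (p 0 ^ 2 + p 1 ^ 2 < R₁⁻¹ ^ 2 ∧ p 2 ^ 2 + p 3 ^ 2 < R₁⁻¹ ^ 2) ∧ ηC p = y)) →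
        (∀ p q : E4, p 2 = 0 → p 3 = 0 → q 0 = 0 → q 1 = 0 → ηH p ≠ ηV q) →
        (∀ p : E4, p 2 = 0 → p 3 = 0 → ηH p ≠ ηC 0) →
        (∀ q : E4, q 0 = 0 → q 1 = 0 → ηV q ≠ ηC 0) →
        ∃ lamV lamH : X → X,
          ContMDiff (𝓡 4) (𝓡 4) ∞ lamV ∧
          ContMDiff (𝓡 4) (𝓡 4) ∞ lamH ∧
          (∀ y : X, (∃ p : E4, p 2 = 0 ∧ p 3 = 0 ∧ ηH p = lamV y) ∨ lamV y = ηC 0) ∧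
          (∀ p : E4, p 2 = 0 → p 3 = 0 → lamV (ηH p) = ηH p) ∧
          lamV (ηC 0) = ηC 0 ∧
          (∀ y : X, (∃ q : E4, q 0 = 0 ∧ q 1 = 0 ∧ ηV q = lamH y) ∨ lamH y = ηC 0) ∧
          (∀ q : E4, q 0 = 0 → q 1 = 0 → lamH (ηV q) = ηV q) ∧
          lamH (ηC 0) = ηC 0 ∧
          (∀ y : X, lamV y = ηC 0 ↔ ((∃ q : E4, q 0 = 0 ∧ q 1 = 0 ∧ ηV q = y) ∨ y = ηC 0)) ∧
          (∀ y : X, lamH y = ηC 0 ↔ ((∃ p : E4, p 2 = 0 ∧ p 3 = 0 ∧ ηH p = y) ∨ y = ηC 0)) ∧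
          (∀ y y' : X, lamV y = lamV y' → lamH y = lamH y' → y = y') ∧
          (∀ p q : E4, p 2 = 0 → p 3 = 0 → q 0 = 0 → q 1 = 0 →
            ∃ y : X, lamV y = ηH p ∧ lamH y = ηV q) ∧
          (∀ (y : X) (v : TangentSpace (𝓡 4) y), mfderiv (𝓡 4) (𝓡 4) lamV y v = 0 →
            mfderiv (𝓡 4) (𝓡 4) lamV y (JX y v) = 0) ∧
          (∀ (y : X) (v : TangentSpace (𝓡 4) y), mfderiv (𝓡 4) (𝓡 4) lamH y v = 0 →
            mfderiv (𝓡 4) (𝓡 4) lamH y (JX y v) = 0) ∧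
          (∀ (y : X) (v : TangentSpace (𝓡 4) y), mfderiv (𝓡 4) (𝓡 4) lamV y v = 0 →
            mfderiv (𝓡 4) (𝓡 4) lamH y v = 0 → v = 0) := by
  intro hF1 hF2 hF3 hF4 hF6 hF6' M _ _ _ _ _ _ J R₁ χ hπ hR₁ X _ _ _ _ _ _ _ ωX JX ι ηH ηV ηC hcap hdHV
    hdH hdV
  obtain ⟨u₀, v₀, uH, vH, F₀, FH, TH, TV, UH, UV, δ, D, D', hu₀, hv₀, huH, hvH⟩ :=
    helper_capFoliationData M J R₁ χ hπ hR₁ X ωX JX ι ηH ηV ηC hcap hdHV hdH hdV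
  obtain ⟨lamV, lamH, hVs, hHs, hVmem, hVret, hHmem, hHret, hVcor, hHcor, hinj, hsurj, hVJ, hHJ,
    htr⟩ := helper_twoFamilies X ωX JX u₀ v₀ uH vH F₀ FH TH TV UH UV δ hF1 hF2 hF3 hF4 hF6 hF6' D D'
  have hH := mem_pairImage_H_iff huH hvH (ηC := ηC)
  have hV := mem_pairImage_V_iff hu₀ hv₀ (ηC := ηC)
  refine ⟨lamV, lamH, hVs, hHs, fun y => (hH _).1 (hVmem y), fun p h2 h3 => hVret _ ?_, hVret _ ?_,
    fun y => (hV _).1 (hHmem y), fun q h0 h1 => hHret _ ?_, hHret _ ?_, fun y => ?_, fun y => ?_,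
    hinj, fun p q h2 h3 h0 h1 => hsurj _ _ ?_ ?_, hVJ, hHJ, htr⟩
  · exact (hH _).2 (Or.inl ⟨p, h2, h3, rfl⟩)
  · exact (hH _).2 (Or.inr rfl)
  · exact (hV _).2 (Or.inl ⟨q, h0, h1, rfl⟩)
  · exact (hV _).2 (Or.inr rfl)
  · exact ⟨fun h => (hV y).1 ((hVcor y).1 (h.trans hv₀.symm)),
      fun h => ((hVcor y).2 ((hV y).2 h)).trans hv₀⟩
  · exact ⟨fun h => (hH y).1 ((hHcor y).1 (h.trans hv₀.symm)),
      fun h => ((hHcor y).2 ((hH y).2 h)).trans hv₀⟩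
  · exact (hH _).2 (Or.inl ⟨p, h2, h3, rfl⟩)
  · exact (hV _).2 (Or.inl ⟨q, h0, h1, rfl⟩)

end Summit.SmoothPoincare4.SmoothPoincare4.Theorems.GromovRecognitionRelEnd.CrossCapLaurent

end
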